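import Mathlib.Algebra.Algebra.Equiv
import Mathlib.Algebra.MvPolynomial.Monad
import Mathlib.Algebra.MvPolynomial.Funext
import Literature.NumberTheory.Automorphic.HarishChandraGLSpan
import Literature.NumberTheory.Automorphic.HarishChandraGLModel
import HarnessLib

/-!
# Harish-Chandra parameters under twisting by a character of `𝔤𝔩ₙ(𝕜)` and under isomorphisms

Topic `NumberTheory/Automorphic`; theorems only (no definition, no named fact). `𝕜` is `ℝ` or `ℂ`
(`RCLike 𝕜`), `𝔤 = 𝔤𝔩ₙ(𝕜)` as a real Lie algebra, `U(𝔤) = UGL 𝕜 n` its real enveloping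
algebra, `Z(𝔤)` its centre, and `HasHCParameter ρ χ` the accepted predicate of `HarishChandraGL`
(Harish-Chandra parameter `χ : (𝕜 →ₐ[ℝ] ℂ) → Multiset ℂ` of a `𝔤`-module). The archimedean
step of "twisting an automorphic representation by `|det|^s`" (Borel–Jacquet 1979, 5.7;
Buzzard–Gee 2014, §3.1 and §5.3: `C`-algebraic = `L`-algebraic after the twist by
`|det|^{(n-1)/2}`) is the following statement about `𝔤`-modules, proved here:

* `HasHCParameter.of_add_smul_one` — **twisting by a real character `δ` of `𝔤` shifts the
  Harish-Chandra parameter.** If `ρ' X = ρ X + δ(X) · 1` for a real linear form `δ` on `𝔤`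
  vanishing on brackets and on `𝔫`, with `δ(diag h) = ∑_τ c_τ ∑_i τ(h_i)` (e.g.
  `δ = s · ∑_τ τ ∘ tr`, `c_τ = s`: the differential of `|det|_w^s` at a real (`τ = id`) or
  complex (`τ ∈ {id, conj}`, `|z|_w = z z̄`) place `w`), then a module with parameter `χ` for `ρ`
  has parameter `τ ↦ χ τ + c_τ` for `ρ'` (on `ℂˣ ⊆ W_{K_w}`: `(a_i, b_i) ↦ (a_i + s, b_i + s)`).
  Proof: `X ↦ X + δ(X)` extends to an algebra endomorphism `A_δ` of `U(𝔤)` (`exists_shiftHom`)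
  with inverse `A_{-δ}`, hence preserving `Z(𝔤)`; `U(𝔤)` acts in `ρ'` through `A_δ`
  (`lift_eq_lift_shift`), so `ρ'` has central character `θ ∘ A_δ`; and for every Harish-Chandra
  homomorphism `γ`, **`γ(A_δ z) = γ(z)(x + c)`** (`HarishChandraHomGL.toAlgHom_shift`) — both
  sides are polynomials, compared at every weight `λ + ρ` on the highest weight vectors of the
  model modules of `HarishChandraGLModel` (a highest weight vector of weight `λ` for `ρ_M` is one of
  weight `λ + c` for `ρ_M + δ`). Knapp 2002, Thm. 5.44 and §V.5; Dixmier, *Enveloping Algebras*,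
  2.2 (the automorphisms `X ↦ X + δ(X)`).
* `HasHCParameter.of_conj` — parameters are invariant under isomorphism of `𝔤`-modules
  (`ρ' X ∘ e = e ∘ ρ X` for a linear equivalence `e`): the central character is the same.

Consumers: the archimedean parameter of the Borel–Jacquet twist `π ⊗ |det|_𝔸^s`
(`AutomorphicTwistNorm`), i.e. the unitary normalisation step of Arthur–Clozel / Henniart
("on se ramène au cas unitaire") read on infinity types, and Buzzard–Gee's `C ↔ L` half-twist.

## References

* A. W. Knapp, *Lie Groups Beyond an Introduction*, 2nd ed. (2002), §V.5, Thm. 5.44.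
* J. Dixmier, *Enveloping Algebras* (1996), 2.1–2.2.
* A. Borel, H. Jacquet, Corvallis (1979), 5.7; K. Buzzard, T. Gee (2014), §3.1, §5.3.
-/

-- Mathlib idiom (Mathlib/Algebra/Lie/OfAssociative.lean): the commutator bracket on matrices
attribute [local instance 100] LieRing.ofAssociativeRing

open scoped Matrix

noncomputable section

namespace Literature.NumberTheory.Automorphic

open UniversalEnvelopingAlgebra MvPolynomial HCSpan

variable {𝕜 : Type*} [RCLike 𝕜] {n : ℕ}

/-! ### Twisting a Lie algebra representation by a scalar character -/

section LieTwist

variable {V : Type*} [AddCommGroup V] [Module ℂ V]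

/-- **Twist of a Lie algebra action by a real scalar character**: for `ρ : 𝔤 → End_ℂ V` and a
real linear form `δ` on `𝔤` vanishing on brackets, `X ↦ ρ X + δ(X) · 1` is a Lie algebra
homomorphism (scalars are central). Dixmier, 2.2. [folklore] -/
theorem exists_lieHom_add_real_smul_one (ρ : Matrix (Fin n) (Fin n) 𝕜 →ₗ⁅ℝ⁆ Module.End ℂ V)
    (δ : Matrix (Fin n) (Fin n) 𝕜 →ₗ[ℝ] ℝ) (hδ : ∀ X Y : Matrix (Fin n) (Fin n) 𝕜, δ ⁅X, Y⁆ = 0) :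
    ∃ ρ' : Matrix (Fin n) (Fin n) 𝕜 →ₗ⁅ℝ⁆ Module.End ℂ V,
      ∀ X, ρ' X = ρ X + ((δ X : ℝ) : ℂ) • (1 : Module.End ℂ V) := by
  refine ⟨{ toFun := fun X => ρ X + ((δ X : ℝ) : ℂ) • (1 : Module.End ℂ V)
            map_add' := fun X Y => by
              simp only [map_add, Complex.ofReal_add, add_smul]; abel
            map_smul' := fun r X => by
              simp only [map_smul, RingHom.id_apply, smul_add, smul_eq_mul, Complex.ofReal_mul]
              rw [mul_smul, Complex.coe_smul]
            map_lie' := fun {X Y} => ?_ }, fun X => rfl⟩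
  simp only [hδ, Complex.ofReal_zero, zero_smul, add_zero, LieHom.map_lie]
  rw [LieRing.of_associative_ring_bracket, LieRing.of_associative_ring_bracket]
  simp only [mul_add, add_mul, smul_mul_assoc, mul_smul_comm, one_mul, mul_one, smul_add, smul_smul,
    mul_comm (((δ Y : ℝ) : ℂ)) (((δ X : ℝ) : ℂ))]
  abel

end LieTwist

/-! ### The shift endomorphism `A_δ : X ↦ X + δ(X)` of `U(𝔤)` -/

section Shift

/-- **The shift homomorphism** `A_δ : U(𝔤) → U(𝔤)`, `X ↦ X + δ(X) · 1`, for a real linear form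
`δ` on `𝔤` vanishing on brackets (universal property: `X ↦ ι X + δ(X)` is a Lie algebra map into
`U(𝔤)`). Dixmier, *Enveloping Algebras*, 2.1.1 and 2.2. [folklore] -/
theorem exists_shiftHom (δ : Matrix (Fin n) (Fin n) 𝕜 →ₗ[ℝ] ℝ)
    (hδ : ∀ X Y : Matrix (Fin n) (Fin n) 𝕜, δ ⁅X, Y⁆ = 0) :
    ∃ A : UGL 𝕜 n →ₐ[ℝ] UGL 𝕜 n,
      ∀ X : Matrix (Fin n) (Fin n) 𝕜, A (ι ℝ X) = ι ℝ X + algebraMap ℝ (UGL 𝕜 n) (δ X) := by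
  let L : Matrix (Fin n) (Fin n) 𝕜 →ₗ⁅ℝ⁆ UGL 𝕜 n :=
    { toFun := fun X => ι ℝ X + algebraMap ℝ (UGL 𝕜 n) (δ X)
      map_add' := fun X Y => by simp only [map_add]; abel
      map_smul' := fun r X => by
        have h1 : (ι ℝ) (r • X) = r • (ι ℝ) X := (ι ℝ).map_smul r X
        have h2 : δ (r • X) = r * δ X := by rw [LinearMap.map_smul, smul_eq_mul]
        rw [RingHom.id_apply, h1, h2, map_mul, smul_add,
          Algebra.smul_def r (algebraMap ℝ (UGL 𝕜 n) (δ X))]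
      map_lie' := fun {X Y} => by
        rw [hδ, map_zero, add_zero, LieHom.map_lie, LieRing.of_associative_ring_bracket,
          LieRing.of_associative_ring_bracket]
        simp only [mul_add, add_mul]
        rw [Algebra.commutes (δ X) ((ι ℝ) Y), Algebra.commutes (δ Y) ((ι ℝ) X),
          Algebra.commutes (δ X) (algebraMap ℝ (UGL 𝕜 n) (δ Y))]
        abel }
  exact ⟨lift ℝ L, fun X => by rw [lift_ι_apply]; rfl⟩

/-- Shift homomorphisms for `δ` and `-δ` are mutually inverse. [folklore] -/
theorem shiftHom_comp_shiftHom {δ δ' : Matrix (Fin n) (Fin n) 𝕜 →ₗ[ℝ] ℝ}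
    (hδδ' : ∀ X, δ' X = -δ X) {A B : UGL 𝕜 n →ₐ[ℝ] UGL 𝕜 n}
    (hA : ∀ X : Matrix (Fin n) (Fin n) 𝕜, A (ι ℝ X) = ι ℝ X + algebraMap ℝ (UGL 𝕜 n) (δ X))
    (hB : ∀ X : Matrix (Fin n) (Fin n) 𝕜, B (ι ℝ X) = ι ℝ X + algebraMap ℝ (UGL 𝕜 n) (δ' X)) :
    A.comp B = AlgHom.id ℝ (UGL 𝕜 n) := by
  apply UniversalEnvelopingAlgebra.hom_ext
  refine LieHom.ext fun X => ?_
  simp only [LieHom.coe_comp, Function.comp_apply, AlgHom.coe_toLieHom, AlgHom.coe_comp,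
    AlgHom.coe_id, id_eq]
  rw [hB, map_add, hA, AlgHom.commutes, hδδ', map_neg, add_neg_cancel_right]

/-- A shift homomorphism is surjective (it has the right inverse `A_{-δ}`). [folklore] -/
theorem shiftHom_surjective {δ : Matrix (Fin n) (Fin n) 𝕜 →ₗ[ℝ] ℝ}
    (hδ : ∀ X Y : Matrix (Fin n) (Fin n) 𝕜, δ ⁅X, Y⁆ = 0) {A : UGL 𝕜 n →ₐ[ℝ] UGL 𝕜 n}
    (hA : ∀ X : Matrix (Fin n) (Fin n) 𝕜, A (ι ℝ X) = ι ℝ X + algebraMap ℝ (UGL 𝕜 n) (δ X)) :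
    Function.Surjective A := by
  obtain ⟨B, hB⟩ := exists_shiftHom (-δ) (fun X Y => by rw [LinearMap.neg_apply, hδ, neg_zero])
  have h := shiftHom_comp_shiftHom (δ := δ) (δ' := -δ) (fun X => rfl) hA hB
  intro u
  exact ⟨B u, by rw [← AlgHom.comp_apply, h, AlgHom.coe_id, id_eq]⟩

/-- A shift homomorphism maps the centre `Z(𝔤)` into itself (it is surjective). [folklore] -/
theorem shiftHom_mem_center {δ : Matrix (Fin n) (Fin n) 𝕜 →ₗ[ℝ] ℝ}
    (hδ : ∀ X Y : Matrix (Fin n) (Fin n) 𝕜, δ ⁅X, Y⁆ = 0) {A : UGL 𝕜 n →ₐ[ℝ] UGL 𝕜 n}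
    (hA : ∀ X : Matrix (Fin n) (Fin n) 𝕜, A (ι ℝ X) = ι ℝ X + algebraMap ℝ (UGL 𝕜 n) (δ X))
    (z : Subalgebra.center ℝ (UGL 𝕜 n)) : A (z : UGL 𝕜 n) ∈ Subalgebra.center ℝ (UGL 𝕜 n) := by
  rw [Subalgebra.mem_center_iff]
  intro u
  obtain ⟨u', rfl⟩ := shiftHom_surjective hδ hA u
  rw [← map_mul, ← map_mul, (Subalgebra.mem_center_iff.mp z.2) u']

variable {V : Type*} [AddCommGroup V] [Module ℂ V]

/-- **`U(𝔤)` acts in the twisted representation through the shift homomorphism**: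
`lift ρ' = lift ρ ∘ A_δ` for `ρ' X = ρ X + δ(X) · 1`. [folklore] -/
theorem lift_eq_lift_shift {δ : Matrix (Fin n) (Fin n) 𝕜 →ₗ[ℝ] ℝ} {A : UGL 𝕜 n →ₐ[ℝ] UGL 𝕜 n}
    (hA : ∀ X : Matrix (Fin n) (Fin n) 𝕜, A (ι ℝ X) = ι ℝ X + algebraMap ℝ (UGL 𝕜 n) (δ X))
    {ρ ρ' : Matrix (Fin n) (Fin n) 𝕜 →ₗ⁅ℝ⁆ Module.End ℂ V}
    (hρ' : ∀ X, ρ' X = ρ X + ((δ X : ℝ) : ℂ) • (1 : Module.End ℂ V)) :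
    lift ℝ ρ' = (lift ℝ ρ).comp A := by
  apply UniversalEnvelopingAlgebra.hom_ext
  refine LieHom.ext fun X => ?_
  simp only [LieHom.coe_comp, Function.comp_apply, AlgHom.coe_toLieHom, AlgHom.coe_comp]
  rw [lift_ι_apply, hρ', hA, map_add, lift_ι_apply, AlgHom.commutes, Algebra.algebraMap_eq_smul_one,
    Complex.coe_smul]

/-- **Central character of the twist**: if `Z(𝔤)` acts in `ρ` by `θ`, it acts in
`ρ' = ρ + δ · 1` by `θ ∘ A_δ`. [folklore] -/
theorem HasCentralCharacter.shift {δ : Matrix (Fin n) (Fin n) 𝕜 →ₗ[ℝ] ℝ}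
    (hδ : ∀ X Y : Matrix (Fin n) (Fin n) 𝕜, δ ⁅X, Y⁆ = 0) {A : UGL 𝕜 n →ₐ[ℝ] UGL 𝕜 n}
    (hA : ∀ X : Matrix (Fin n) (Fin n) 𝕜, A (ι ℝ X) = ι ℝ X + algebraMap ℝ (UGL 𝕜 n) (δ X))
    {ρ ρ' : Matrix (Fin n) (Fin n) 𝕜 →ₗ⁅ℝ⁆ Module.End ℂ V}
    (hρ' : ∀ X, ρ' X = ρ X + ((δ X : ℝ) : ℂ) • (1 : Module.End ℂ V))
    {θ : Subalgebra.center ℝ (UGL 𝕜 n) →ₐ[ℝ] ℂ} (hθ : HasCentralCharacter ρ θ) :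
    ∃ θ' : Subalgebra.center ℝ (UGL 𝕜 n) →ₐ[ℝ] ℂ, HasCentralCharacter ρ' θ' ∧
      ∀ z, θ' z = θ ⟨A z, shiftHom_mem_center hδ hA z⟩ := by
  let A' : Subalgebra.center ℝ (UGL 𝕜 n) →ₐ[ℝ] Subalgebra.center ℝ (UGL 𝕜 n) :=
    (A.comp (Subalgebra.center ℝ (UGL 𝕜 n)).val).codRestrict (Subalgebra.center ℝ (UGL 𝕜 n))
      fun z => shiftHom_mem_center hδ hA z
  refine ⟨θ.comp A', fun z => ?_, fun z => rfl⟩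
  rw [lift_eq_lift_shift hA hρ', AlgHom.comp_apply, AlgHom.comp_apply]
  exact hθ ⟨A z, shiftHom_mem_center hδ hA z⟩

end Shift

/-! ### Highest weight vectors of the twist and the shift of Harish-Chandra polynomials -/

section HighestWeight

variable {V : Type*} [AddCommGroup V] [Module ℂ V]

/-- `weightFun` is additive in the weight. [folklore] -/
theorem weightFun_add (l l' : ArchWeightGL 𝕜 n) (h : Fin n → 𝕜) :
    weightFun (l + l') h = weightFun l h + weightFun l' h := by
  simp only [weightFun, Pi.add_apply, add_mul, Finset.sum_add_distrib]

/-- **A highest weight vector of weight `λ` for `ρ` is a highest weight vector of weight `λ + c`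
for the twist `ρ' = ρ + δ · 1`**, when `δ` kills `𝔫` and `δ(diag h) = ∑_τ c_τ ∑_i τ(h_i)`.
Knapp 2002, §V.5. [folklore] -/
theorem IsHighestWeightVector.shift {δ : Matrix (Fin n) (Fin n) 𝕜 →ₗ[ℝ] ℝ}
    (hδn : ∀ X ∈ upperNilpLie 𝕜 n, δ X = 0) {c : (𝕜 →ₐ[ℝ] ℂ) → ℂ}
    (hδc : ∀ h : Fin n → 𝕜,
      ((δ (Matrix.diagonal h) : ℝ) : ℂ) = weightFun (fun τ (_ : Fin n) => c τ) h)
    {ρ ρ' : Matrix (Fin n) (Fin n) 𝕜 →ₗ⁅ℝ⁆ Module.End ℂ V}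
    (hρ' : ∀ X, ρ' X = ρ X + ((δ X : ℝ) : ℂ) • (1 : Module.End ℂ V))
    {l : ArchWeightGL 𝕜 n} {v : V} (hv : IsHighestWeightVector ρ l v) :
    IsHighestWeightVector ρ' (l + fun τ _ => c τ) v := by
  refine ⟨hv.1, fun X hX => ?_, fun h => ?_⟩
  · rw [hρ', LinearMap.add_apply, hv.2.1 X hX, hδn X hX, Complex.ofReal_zero, zero_smul,
      LinearMap.zero_apply, add_zero]
  · rw [hρ', LinearMap.add_apply, hv.2.2 h, LinearMap.smul_apply, Module.End.one_apply, hδc,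
      ← add_smul, weightFun_add]

/-- **Shift of the Harish-Chandra polynomial**: for every Harish-Chandra homomorphism `γ` and
central `z`, `γ(A_δ z) = γ(z)(x_{τ,i} + c_τ)` — both sides computed on the highest weight vectors
of the model modules of every weight (`HCModel.hwVec`, file `HarishChandraGLModel`), where `z`
acts in the twisted model by `γ(z)(λ + c + ρ)` and `A_δ z` acts in the model by `γ(A_δ z)(λ + ρ)`;
two polynomials agreeing at all points of `ℂ^{T × n}` are equal. Knapp 2002, Thm. 5.44.
[cite: Knapp2002, §V.5 Thm. 5.44] -/
theorem HarishChandraHomGL.toAlgHom_shift (γ : HarishChandraHomGL 𝕜 n)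
    {δ : Matrix (Fin n) (Fin n) 𝕜 →ₗ[ℝ] ℝ} (hδ : ∀ X Y : Matrix (Fin n) (Fin n) 𝕜, δ ⁅X, Y⁆ = 0)
    (hδn : ∀ X ∈ upperNilpLie 𝕜 n, δ X = 0) {c : (𝕜 →ₐ[ℝ] ℂ) → ℂ}
    (hδc : ∀ h : Fin n → 𝕜,
      ((δ (Matrix.diagonal h) : ℝ) : ℂ) = weightFun (fun τ (_ : Fin n) => c τ) h)
    {A : UGL 𝕜 n →ₐ[ℝ] UGL 𝕜 n}
    (hA : ∀ X : Matrix (Fin n) (Fin n) 𝕜, A (ι ℝ X) = ι ℝ X + algebraMap ℝ (UGL 𝕜 n) (δ X))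
    (z : Subalgebra.center ℝ (UGL 𝕜 n)) :
    γ.toAlgHom ⟨A z, shiftHom_mem_center hδ hA z⟩ =
      bind₁ (fun p : (𝕜 →ₐ[ℝ] ℂ) × Fin n => X p + C (c p.1)) (γ.toAlgHom z) := by
  classical
  apply MvPolynomial.funext
  intro x
  -- the weight `l₀` with `x = l₀ + ρ`
  set l₀ : ArchWeightGL 𝕜 n := fun τ j => x (τ, j) - rhoGL n j with hl₀
  have hx : x = fun p : (𝕜 →ₐ[ℝ] ℂ) × Fin n => l₀ p.1 p.2 + rhoGL n p.2 := by
    funext p; simp [hl₀]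
  -- the model module of weight `l₀` and its twist
  have hv := HCModel.isHighestWeightVector_hwVec (𝕜 := 𝕜) l₀
  obtain ⟨ρ', hρ'⟩ := exists_lieHom_add_real_smul_one (HCModel.modelRep 𝕜 n).rho δ hδ
  have hv' := IsHighestWeightVector.shift hδn hδc hρ' hv
  -- `z` acts on the twisted model by `γ(z)(l₀ + c + ρ)`, and through `A_δ z` on the model
  have h1 := γ.highestWeight _ ρ' _ _ hv' z
  rw [lift_eq_lift_shift hA hρ', AlgHom.comp_apply] at h1
  have h2 := γ.highestWeight _ (HCModel.modelRep 𝕜 n).rho l₀ _ hv ⟨A z, shiftHom_mem_center hδ hA z⟩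
  -- compare the two scalars and conclude pointwise
  have h3 := smul_left_injective ℂ (HCModel.hwVec_ne_zero l₀) (h2.symm.trans h1)
  have hfun : (fun p : (𝕜 →ₐ[ℝ] ℂ) × Fin n =>
      aeval (fun p : (𝕜 →ₐ[ℝ] ℂ) × Fin n => l₀ p.1 p.2 + rhoGL n p.2) (X p + C (c p.1))) =
      fun p : (𝕜 →ₐ[ℝ] ℂ) × Fin n => (l₀ + fun τ (_ : Fin n) => c τ) p.1 p.2 + rhoGL n p.2 := by
    funext p
    simp only [map_add, aeval_X, aeval_C, Algebra.algebraMap_self, RingHom.id_apply, Pi.add_apply]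
    ring
  change aeval x _ = aeval x _
  rw [aeval_bind₁, hx, h3, hfun]

end HighestWeight

/-! ### Harish-Chandra parameters of twists and of isomorphic modules -/

section Parameters

variable {V : Type*} [AddCommGroup V] [Module ℂ V]

/-- An enumeration of `χ τ + c` minus `c` enumerates `χ τ`. [folklore] -/
private theorem univ_val_map_sub_eq {m : ℕ} {s : Multiset ℂ} {c : ℂ} {l' : Fin m → ℂ}
    (hl' : Finset.univ.val.map l' = s.map (· + c)) :
    Finset.univ.val.map (fun i => l' i - c) = s := by
  have e : (fun i => l' i - c) = (fun x : ℂ => x - c) ∘ l' := rfl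
  rw [e, ← Multiset.map_map, hl', Multiset.map_map]
  simp only [Function.comp_def, add_sub_cancel_right, Multiset.map_id']

/-- **Harish-Chandra parameter of a twist by a real scalar character.** Let `ρ' X = ρ X + δ(X)·1`
with `δ` a real linear form on `𝔤𝔩ₙ(𝕜)` vanishing on brackets and on `𝔫`, and
`δ(diag h) = ∑_τ c_τ ∑_i τ(h_i)` (`c : (𝕜 →ₐ[ℝ] ℂ) → ℂ`). If the `𝔤`-module `(V, ρ)` has
Harish-Chandra parameter `χ`, then `(V, ρ')` has Harish-Chandra parameter `τ ↦ χ τ + c_τ`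
(every entry shifted by `c_τ`). For `δ =` the differential of `|det|_w^s` (`c_τ = s` for all
`τ`) this is the archimedean content of Borel–Jacquet's twist `π ⊗ |det|^s` (on the Langlands
parameter restricted to `ℂˣ`: `(a_i, b_i) ↦ (a_i + s, b_i + s)`). Knapp 2002, Thm. 5.44;
Borel–Jacquet 1979, 5.7; Buzzard–Gee 2014, §5.3. [cite: Knapp2002, §V.5 Thm. 5.44] -/
theorem HasHCParameter.of_add_smul_one {δ : Matrix (Fin n) (Fin n) 𝕜 →ₗ[ℝ] ℝ}
    (hδ : ∀ X Y : Matrix (Fin n) (Fin n) 𝕜, δ ⁅X, Y⁆ = 0)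
    (hδn : ∀ X ∈ upperNilpLie 𝕜 n, δ X = 0) {c : (𝕜 →ₐ[ℝ] ℂ) → ℂ}
    (hδc : ∀ h : Fin n → 𝕜,
      ((δ (Matrix.diagonal h) : ℝ) : ℂ) = weightFun (fun τ (_ : Fin n) => c τ) h)
    {ρ ρ' : Matrix (Fin n) (Fin n) 𝕜 →ₗ⁅ℝ⁆ Module.End ℂ V}
    (hρ' : ∀ X, ρ' X = ρ X + ((δ X : ℝ) : ℂ) • (1 : Module.End ℂ V))
    {χ : (𝕜 →ₐ[ℝ] ℂ) → Multiset ℂ} (hχ : HasHCParameter ρ χ) :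
    HasHCParameter ρ' fun τ => (χ τ).map (· + c τ) := by
  obtain ⟨hcard, θ, hθ, hθχ⟩ := hχ
  obtain ⟨A, hA⟩ := exists_shiftHom δ hδ
  obtain ⟨θ', hθ', hθ'θ⟩ := HasCentralCharacter.shift hδ hA hρ' hθ
  refine ⟨fun τ => by rw [Multiset.card_map, hcard], θ', hθ', fun γ l' hl' z => ?_⟩
  -- enumerate `χ` by `l = l' - c`
  have hl : ∀ τ, Finset.univ.val.map (fun i => l' τ i - c τ) = χ τ := fun τ =>
    univ_val_map_sub_eq (hl' τ)
  have hfun : (fun p : (𝕜 →ₐ[ℝ] ℂ) × Fin n =>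
      aeval (fun p : (𝕜 →ₐ[ℝ] ℂ) × Fin n => l' p.1 p.2 - c p.1) (X p + C (c p.1))) =
      fun p : (𝕜 →ₐ[ℝ] ℂ) × Fin n => l' p.1 p.2 := by
    funext p
    simp only [map_add, aeval_X, aeval_C, Algebra.algebraMap_self, RingHom.id_apply, sub_add_cancel]
  rw [hθ'θ z, hθχ γ (fun τ i => l' τ i - c τ) hl ⟨A z, shiftHom_mem_center hδ hA z⟩,
    γ.toAlgHom_shift hδ hδn hδc hA z, aeval_bind₁, hfun]

/-- **Harish-Chandra parameters are invariant under isomorphism of `𝔤`-modules**: if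
`e : V ≃ V'` intertwines `ρ` and `ρ'` (`ρ' X (e v) = e (ρ X v)`), a parameter of `(V, ρ)` is a
parameter of `(V', ρ')` (the central character is transported unchanged). Knapp 2002, §V.5.
[folklore] -/
theorem HasHCParameter.of_conj {V' : Type*} [AddCommGroup V'] [Module ℂ V'] (e : V ≃ₗ[ℂ] V')
    {ρ : Matrix (Fin n) (Fin n) 𝕜 →ₗ⁅ℝ⁆ Module.End ℂ V}
    {ρ' : Matrix (Fin n) (Fin n) 𝕜 →ₗ⁅ℝ⁆ Module.End ℂ V'}
    (he : ∀ (X : Matrix (Fin n) (Fin n) 𝕜) (v : V), ρ' X (e v) = e (ρ X v))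
    {χ : (𝕜 →ₐ[ℝ] ℂ) → Multiset ℂ} (hχ : HasHCParameter ρ χ) : HasHCParameter ρ' χ := by
  obtain ⟨hcard, θ, hθ, hθχ⟩ := hχ
  refine ⟨hcard, θ, fun z => ?_, hθχ⟩
  -- `lift ρ' = conj_e ∘ lift ρ`
  have hlift : lift ℝ ρ' = ((e.conjAlgEquiv ℝ : Module.End ℂ V ≃ₐ[ℝ] Module.End ℂ V') :
      Module.End ℂ V →ₐ[ℝ] Module.End ℂ V').comp (lift ℝ ρ) := by
    apply UniversalEnvelopingAlgebra.hom_ext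
    refine LieHom.ext fun X => ?_
    simp only [LieHom.coe_comp, Function.comp_apply, AlgHom.coe_toLieHom, AlgHom.coe_comp,
      AlgEquiv.coe_toAlgHom]
    rw [lift_ι_apply, lift_ι_apply, LinearEquiv.conjAlgEquiv_apply]
    refine LinearMap.ext fun v' => ?_
    simp only [LinearMap.coe_comp, Function.comp_apply, LinearEquiv.coe_toLinearMap]
    rw [← he, LinearEquiv.apply_symm_apply]
  rw [hlift, AlgHom.comp_apply, hθ z, AlgEquiv.coe_toAlgHom, LinearEquiv.conjAlgEquiv_apply]
  refine LinearMap.ext fun v' => ?_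
  simp only [LinearMap.coe_comp, Function.comp_apply, LinearEquiv.coe_toLinearMap,
    Module.algebraMap_end_apply, map_smul, LinearEquiv.apply_symm_apply]

end Parameters

end Literature.NumberTheory.Automorphic
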